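import Summits.NavierStokesRegularity.NavierStokesRegularity.Theorems.EfficiencyFloorProductionEfficiencyDecayViolationStructure
import Summits.NavierStokesRegularity.NavierStokesRegularity.Theorems.EfficiencyFloorProductionEfficiencyDecayMeanForm
import Summits.NavierStokesRegularity.NavierStokesRegularity.Theorems.StretchingWellBindingEnstrophyQuarterLawGradientTypeI
import Summits.NavierStokesRegularity.NavierStokesRegularity.Theorems.ProductionEfficiencyDecay.Negative.ProductionEfficiencyDecayFalseOfDssLerayHopfBlowup
import Summits.NavierStokesRegularity.NavierStokesRegularity.Theses.EfficiencyFloor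
import Summits.NavierStokesRegularity.NavierStokesRegularity.Theses.TypeILiouville
import HarnessLib

/-!
# Crux `EfficiencyFloor.ProductionEfficiencyDecay` (stmt-NavierStokesRegularity-22866) ON THE VELOCITY-TYPE-I STRATUM:
# the POINTWISE crux (its registered crux-proper stub S2) is EQUIVALENT to its MEAN form — the super-Leray floor

Helper file (`--supports stmt-NavierStokesRegularity-22866`; line `efficiency_floor`, registered skeleton
`Cruxes/ProductionEfficiencyDecay/Lines/efficiency_floor.lean`, whose only active stub `stub_depletionGivenBudget` IS the
crux, `…ProductionEfficiencyDecayReduction`, p585755). No registered stub and no crux is closed here.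

CONTEXT. `…ProductionEfficiencyDecayMeanForm` (p825059) showed that the route's deciding theorem consumes only the MEAN
form of the crux (`Z(s)⁻² ≤ ε(T−s)` late, ⟺ the super-Leray floor `∀ K`, eventually `K/√(T−t) < Z(t)`), and
`…MeanFormSeparation` (p825300) that among the scalar facts the tree knows (`Z > 0`, cubic law `Ż ≤ KZ³`, `Z → ∞`) the
POINTWISE crux (`Ż ≤ εZ³` eventually, every `ε`) is STRICTLY stronger: late oscillations of the Lu–Doering efficiency
`Ż/Z³` at frequency `∼(T−t)⁻²` separate the two, "a Navier–Stokes-specific statement no mechanism of the line addresses".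

THIS FILE supplies that mechanism on the velocity-Type-I stratum (`IsTypeIBlowup u T`: `|u(t,x)| ≤ C₀/√(T−t)` near
`T`; class form: the sibling crux `TypeIliouvilleNoTypeII`, stmt-0056). There the Koch–Nadirashvili–Seregin–Šverák
smoothing already in the tree (`EnstrophyQuarterLaw.LambBudget.gradientTypeIOfTypeI`, p-landed: `‖∇u(t)‖_∞ ≤ C/(T−t)`
near `T`) bounds the stretching term of the registered budget triple POINTWISE IN TIME,
`S(t) = ∫⟪ω, ∇u ω⟫ ≤ ‖∇u(t)‖_∞ Z(t) ≤ C Z(t)/(T−t)` (`stretching_le_of_norm_fderiv_le`, one instant, Cauchy–Schwarz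
only), so `Ż = 2S − 2ν·Pal ≤ 2C Z/(T−t)`; and the super-Leray floor `Z(t)² (T−t) > 2C/ε` turns this into `Ż ≤ ε Z³`.
Hence:

* `depletion_of_isTypeIBlowup_of_floor` (ONE solution, registered-stub currency): velocity Type I + the super-Leray
  floor ⟹ the conclusion of `stub_depletionGivenBudget` for that solution (`∃ t₁ ∈ (0,T), ∀ t ∈ [t₁,T), 0 < Z ∧
  2S − 2ν·Pal ≤ ε Z³`), for every budget triple `(Z, Pal, S)` (clauses verbatim);
* `efficiencyDecayLaw_of_isTypeIBlowup_of_floor` (ONE solution, crux currency): the same two hypotheses give the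
  crux's ε-law (window `0 < Z < ⊤` and `Z(s)⁻² − Z(t)⁻² ≤ ε(t−s)`), through the landed budget (stmt-22995) and
  integration step (`ProductionEfficiencyDecay.stub_integrateEfficiency`);
* `efficiencyDecayLaw_iff_floor_of_isTypeIBlowup`: on a velocity-Type-I blow-up the POINTWISE ε-law and the
  super-Leray FLOOR are EQUIVALENT (converse = the lead's `ProductionEfficiencyDecayNegative.floor_eventually_of_window_law`);
* BY NAME: `stub_depletionGivenBudget_of_noTypeII_of_floor` (0056 ∧ floor ⟹ the registered stub S2, signature verbatim),
  `productionEfficiencyDecay_of_noTypeII_of_floor`, and the two equivalences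
  `productionEfficiencyDecay_iff_floor_of_noTypeII : TypeIliouvilleNoTypeII → (ProductionEfficiencyDecay ↔ floor)`,
  `productionEfficiencyDecay_iff_meanForm_of_noTypeII : TypeIliouvilleNoTypeII → (ProductionEfficiencyDecay ↔ mean form)`.

READ-OUT (planner-facing). The extra content of the filed pointwise crux over what `closes` consumes (exclusion of late
efficiency OSCILLATIONS) lives ENTIRELY on the velocity-Type-II stratum: modulo the sibling crux 0056 — weaker than the
route's own residual `EnstrophyQuarterLaw` (1574 ⟹ 0056, `…RegisteredStatus`) — stmt-22866, its mean form and the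
super-Leray floor (conclusion of stmt-22868) are one statement. Equivalently, in the factorisation
`ProductionEfficiencyDecay ↔ ¬LerayRateBlowup ∧ U` of `…FrequentDepletion`, the upgrade `U` («frequently ⟹ eventually»)
is automatic for velocity-Type-I blow-ups. HONEST FRAMING: implications between OPEN statements about HYPOTHETICAL
blow-ups; `IsTypeIBlowup`/0056, the floor, stmt-22866 and Navier–Stokes regularity are NOT proved; no registered stub or
crux is closed; no summit statement is proved. [cite: KochNadirashviliSereginSverak2009, §4 (4.10); LuDoering2008, (5)–(6)]
[folklore]
-/

-- the problem directory repeats the summit name (`NavierStokesRegularity/NavierStokesRegularity`)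
set_option linter.dupNamespace false

noncomputable section

open Set Filter MeasureTheory Topology Function
open scoped InnerProductSpace ENNReal NNReal ContDiff
open Literature.Analysis.FluidPDE

namespace Summit.NavierStokesRegularity.NavierStokesRegularity.Theorems

namespace ProductionEfficiencyDecay

namespace TypeIStratum

/-! ### §1 One instant: the stretching term against the gradient sup-norm -/

/-- **`S ≤ ‖∇v‖_∞ · Z` at one instant.** For a `C²` field `v : ℝ³ → ℝ³` with `Dv ∈ L²` and `‖∇v(x)‖ ≤ G` everywhere,
the vortex-stretching integral obeys `∫⟪curl v, ∇v (curl v)⟫ ≤ G ∫‖curl v‖²` (Cauchy–Schwarz pointwise; the left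
integrand is integrable by domination). [folklore] -/
theorem stretching_le_of_norm_fderiv_le {v : EuclideanSpace ℝ (Fin 3) → EuclideanSpace ℝ (Fin 3)}
    (hv : ContDiff ℝ 2 v) (h1 : ∫⁻ x, ‖iteratedFDeriv ℝ 1 v x‖ₑ ^ 2 < ⊤) {G : ℝ}
    (hG : ∀ x, ‖fderiv ℝ v x‖ ≤ G) :
    ∫ x, ⟪curl v x, fderiv ℝ v x (curl v x)⟫_ℝ ≤ G * ∫ x, ‖curl v x‖ ^ 2 := by
  have hint : Integrable (fun x => ‖curl v x‖ ^ 2) := (integrable_norm_curl_sq hv h1).1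
  have hv1 : ContDiff ℝ 1 v := hv.of_le (by norm_cast)
  have hωc : Continuous (curl v) := continuous_curl hv1
  have hDc : Continuous (fderiv ℝ v) := hv1.continuous_fderiv one_ne_zero
  have hfc : Continuous fun x => ⟪curl v x, fderiv ℝ v x (curl v x)⟫_ℝ :=
    hωc.inner (hDc.clm_apply hωc)
  have hpt : ∀ x, ⟪curl v x, fderiv ℝ v x (curl v x)⟫_ℝ ≤ G * ‖curl v x‖ ^ 2 := by
    intro x
    calc ⟪curl v x, fderiv ℝ v x (curl v x)⟫_ℝ ≤ ‖curl v x‖ * ‖fderiv ℝ v x (curl v x)‖ :=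
          real_inner_le_norm _ _
      _ ≤ ‖curl v x‖ * (G * ‖curl v x‖) := by
          refine mul_le_mul_of_nonneg_left ?_ (norm_nonneg _)
          exact (ContinuousLinearMap.le_opNorm _ _).trans
            (mul_le_mul_of_nonneg_right (hG x) (norm_nonneg _))
      _ = G * ‖curl v x‖ ^ 2 := by ring
  have habs : ∀ x, ‖⟪curl v x, fderiv ℝ v x (curl v x)⟫_ℝ‖ ≤ G * ‖curl v x‖ ^ 2 := by
    intro x
    rw [Real.norm_eq_abs]
    calc |⟪curl v x, fderiv ℝ v x (curl v x)⟫_ℝ| ≤ ‖curl v x‖ * ‖fderiv ℝ v x (curl v x)‖ :=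
          abs_real_inner_le_norm _ _
      _ ≤ ‖curl v x‖ * (G * ‖curl v x‖) := by
          refine mul_le_mul_of_nonneg_left ?_ (norm_nonneg _)
          exact (ContinuousLinearMap.le_opNorm _ _).trans
            (mul_le_mul_of_nonneg_right (hG x) (norm_nonneg _))
      _ = G * ‖curl v x‖ ^ 2 := by ring
  have hgint : Integrable (fun x => G * ‖curl v x‖ ^ 2) := hint.const_mul G
  have hfint : Integrable (fun x => ⟪curl v x, fderiv ℝ v x (curl v x)⟫_ℝ) :=
    hgint.mono' hfc.aestronglyMeasurable (Eventually.of_forall habs)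
  calc ∫ x, ⟪curl v x, fderiv ℝ v x (curl v x)⟫_ℝ ≤ ∫ x, G * ‖curl v x‖ ^ 2 :=
        integral_mono hfint hgint hpt
    _ = G * ∫ x, ‖curl v x‖ ^ 2 := integral_const_mul _ _

/-! ### §2 One solution, registered-stub currency -/

/-- **Velocity Type I + super-Leray floor ⟹ pointwise efficiency decay (the conclusion of the registered crux-proper
stub `stub_depletionGivenBudget`, for ONE solution).** Along a maximal smooth Leray–Hopf rapidly-decaying-datum solution
on `[0,T)` with a velocity-Type-I blow-up at `T` and the super-Leray floor (`∀ K`, eventually `K/√(T−t) < Z(t)`), every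
budget triple `(Z, Pal, S)` (clauses of stmt-22995 verbatim) satisfies, for every `ε > 0`, eventually
`0 < Z ∧ 2S − 2ν·Pal ≤ ε Z³`. (KNSS gradient rate `‖∇u(t)‖ ≤ C/(T−t)` ⟹ `2S ≤ 2C Z/(T−t)`; floor with
`K = √(2C⁺/ε)` ⟹ `2C/(T−t) ≤ ε Z²`.) [cite: KochNadirashviliSereginSverak2009, §4 (4.10)] -/
theorem depletion_of_isTypeIBlowup_of_floor {c ν T : ℝ} (hν : 0 < ν) (hT : 0 < T)
    {u : ℝ → EuclideanSpace ℝ (Fin 3) → EuclideanSpace ℝ (Fin 3)} {p : ℝ → EuclideanSpace ℝ (Fin 3) → ℝ}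
    (hmax : IsMaximalSmoothSolution ν 0 u p T) (hLH : IsLerayHopfOn T ν 0 (u 0) u)
    (hdec : HasRapidSpatialDecay (u 0)) (hI : IsTypeIBlowup u T)
    (hfloor : ∀ K : ℝ, ∀ᶠ t in 𝓝[<] T, ENNReal.ofReal (K / Real.sqrt (T - t)) < ∫⁻ x, ‖curl (u t) x‖ₑ ^ 2)
    {Zr Pr Sr : ℝ → ℝ}
    (hZ : ∀ t ∈ Set.Ioo 0 T, ∫⁻ x, ‖curl (u t) x‖ₑ ^ 2 = ENNReal.ofReal (Zr t) ∧ 0 ≤ Zr t ∧ 0 ≤ Pr t ∧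
      Pr t = ∫ x, frobeniusNormSq (fderiv ℝ (curl (u t)) x) ∧
      Sr t = ∫ x, ⟪curl (u t) x, fderiv ℝ (u t) x (curl (u t) x)⟫_ℝ ∧
      HasDerivAt Zr (2 * Sr t - 2 * ν * Pr t) t ∧ |Sr t| ≤ c * Zr t ^ (3/4 : ℝ) * Pr t ^ (3/4 : ℝ))
    {ε : ℝ} (hε : 0 < ε) :
    ∃ t₁ ∈ Set.Ioo 0 T, ∀ t ∈ Set.Ico t₁ T, 0 < Zr t ∧ 2 * Sr t - 2 * ν * Pr t ≤ ε * Zr t ^ 3 := by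
  obtain ⟨C, hC⟩ :=
    EnstrophyQuarterLaw.LambBudget.gradientTypeIOfTypeI ν T hν hT u p hmax hLH hdec hI
  set Cp : ℝ := max C 0 with hCp
  have hCp0 : 0 ≤ Cp := le_max_right _ _
  have hCCp : C ≤ Cp := le_max_left _ _
  set K : ℝ := Real.sqrt (2 * Cp / ε) with hK
  have hK0 : 0 ≤ K := Real.sqrt_nonneg _
  have hK2 : K ^ 2 = 2 * Cp / ε := by
    rw [hK, Real.sq_sqrt (by positivity)]
  have hIoo : ∀ᶠ t in 𝓝[<] T, t ∈ Ioo 0 T := Ioo_mem_nhdsLT hT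
  have hall : ∀ᶠ t in 𝓝[<] T, t ∈ Ioo 0 T ∧ ((∀ x, ‖fderiv ℝ (u t) x‖ ≤ C / (T - t)) ∧
      ENNReal.ofReal (K / Real.sqrt (T - t)) < ∫⁻ x, ‖curl (u t) x‖ₑ ^ 2) :=
    hIoo.and (hC.and (hfloor K))
  obtain ⟨T₁, hT₁T, hsub⟩ := mem_nhdsLT_iff_exists_Ioo_subset.1 hall
  set t₁ : ℝ := (max T₁ 0 + T) / 2 with ht₁
  have hm : max T₁ 0 < T := max_lt hT₁T hT
  have ht₁I : t₁ ∈ Ioo 0 T := ⟨by rw [ht₁]; linarith [le_max_right T₁ 0], by rw [ht₁]; linarith⟩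
  refine ⟨t₁, ht₁I, fun t ht => ?_⟩
  have hT₁t : T₁ < t := by
    have : max T₁ 0 < t₁ := by rw [ht₁]; linarith
    exact (le_max_left T₁ 0).trans_lt (this.trans_le ht.1)
  obtain ⟨htI, hgrad, hfl⟩ := hsub ⟨hT₁t, ht.2⟩
  obtain ⟨hZeq, hZ0, hP0, -, hSeq, -, -⟩ := hZ t htI
  have hTt : 0 < T - t := sub_pos.2 ht.2
  -- slice regularity and `Zr t = ∫‖curl u(t)‖²`
  obtain ⟨hsm, -, hsob, hZint⟩ := Violation.slice_data hν hT hmax hLH hdec htI hZeq hZ0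
  -- positivity and the floor in real form
  rw [hZeq, ENNReal.ofReal_lt_ofReal_iff'] at hfl
  have hKZ : K / Real.sqrt (T - t) < Zr t := hfl.1
  have hZpos : 0 < Zr t := hfl.2
  -- the stretching bound `Sr t ≤ (C/(T−t)) Zr t`
  have hS : Sr t ≤ C / (T - t) * Zr t := by
    rw [hSeq, hZint]
    exact stretching_le_of_norm_fderiv_le (hsm.of_le (by norm_cast)) (hsob 1) hgrad
  -- `2C/(T−t) ≤ ε Zr²` from the floor
  have hsq : 2 * Cp / (T - t) < ε * Zr t ^ 2 := by
    have h1 : (K / Real.sqrt (T - t)) ^ 2 < Zr t ^ 2 :=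
      pow_lt_pow_left₀ hKZ (div_nonneg hK0 (Real.sqrt_nonneg _)) two_ne_zero
    have h2 : (K / Real.sqrt (T - t)) ^ 2 = 2 * Cp / ε / (T - t) := by
      rw [div_pow, Real.sq_sqrt hTt.le, hK2]
    rw [h2] at h1
    have h3 : 2 * Cp / ε / (T - t) = (2 * Cp / (T - t)) / ε := by ring
    rw [h3, div_lt_iff₀ hε] at h1
    linarith
  have hC' : 2 * C / (T - t) ≤ 2 * Cp / (T - t) := by
    gcongr
  refine ⟨hZpos, ?_⟩
  have hνP : 0 ≤ 2 * ν * Pr t := by positivity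
  calc 2 * Sr t - 2 * ν * Pr t ≤ 2 * Sr t := by linarith
    _ ≤ 2 * (C / (T - t) * Zr t) := by linarith
    _ = 2 * C / (T - t) * Zr t := by ring
    _ ≤ ε * Zr t ^ 2 * Zr t := by
        refine mul_le_mul_of_nonneg_right (hC'.trans hsq.le) hZpos.le
    _ = ε * Zr t ^ 3 := by ring

/-! ### §3 One solution, crux currency -/

/-- **Velocity Type I + super-Leray floor ⟹ the crux's ε-law (ONE solution).** Under the hypotheses of
`depletion_of_isTypeIBlowup_of_floor`, for every `ε > 0` there is `t₁ ∈ [0,T)` with `0 < Z < ⊤` on `[t₁,T)` and the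
every-subinterval law `Z(s)⁻² − Z(t)⁻² ≤ ε(t − s)` (`t₁ ≤ s ≤ t < T`) — the conclusion of
`Theses.EfficiencyFloor.ProductionEfficiencyDecay` for this solution (budget stmt-22995 + §2 + the landed integration
step, exactly the registered skeleton's composition). [folklore] -/
theorem efficiencyDecayLaw_of_isTypeIBlowup_of_floor {ν T : ℝ} (hν : 0 < ν) (hT : 0 < T)
    {u : ℝ → EuclideanSpace ℝ (Fin 3) → EuclideanSpace ℝ (Fin 3)} {p : ℝ → EuclideanSpace ℝ (Fin 3) → ℝ}
    (hmax : IsMaximalSmoothSolution ν 0 u p T) (hLH : IsLerayHopfOn T ν 0 (u 0) u)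
    (hdec : HasRapidSpatialDecay (u 0)) (hI : IsTypeIBlowup u T)
    (hfloor : ∀ K : ℝ, ∀ᶠ t in 𝓝[<] T, ENNReal.ofReal (K / Real.sqrt (T - t)) < ∫⁻ x, ‖curl (u t) x‖ₑ ^ 2) :
    ∀ ε : ℝ, 0 < ε → ∃ t₁ ∈ Set.Ico 0 T, (∀ t ∈ Set.Ico t₁ T,
        0 < ∫⁻ x, ‖curl (u t) x‖ₑ ^ 2 ∧ ∫⁻ x, ‖curl (u t) x‖ₑ ^ 2 < ⊤) ∧
        ∀ s t : ℝ, t₁ ≤ s → s ≤ t → t < T →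
          ((∫⁻ x, ‖curl (u s) x‖ₑ ^ 2).toReal)⁻¹ ^ 2 - ((∫⁻ x, ‖curl (u t) x‖ₑ ^ 2).toReal)⁻¹ ^ 2 ≤
            ε * (t - s) := by
  intro ε hε
  obtain ⟨c, _, hB⟩ := EnstrophyBudget.main
  obtain ⟨Zr, Pr, Sr, hZ⟩ := hB ν T hν hT u p hmax hLH hdec
  obtain ⟨t₁, ht₁, hdep⟩ :=
    depletion_of_isTypeIBlowup_of_floor hν hT hmax hLH hdec hI hfloor hZ (half_pos hε)
  have hIoo : ∀ t ∈ Ico t₁ T, t ∈ Ioo 0 T := fun t ht => ⟨ht₁.1.trans_le ht.1, ht.2⟩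
  have hpos : ∀ t ∈ Ico t₁ T, 0 < Zr t := fun t ht => (hdep t ht).1
  have hder : ∀ t ∈ Ico t₁ T, ∃ D : ℝ, HasDerivAt Zr D t ∧ D ≤ ε / 2 * Zr t ^ 3 := fun t ht =>
    ⟨2 * Sr t - 2 * ν * Pr t, (hZ t (hIoo t ht)).2.2.2.2.2.1, (hdep t ht).2⟩
  refine ⟨t₁, ⟨ht₁.1.le, ht₁.2⟩, fun t ht => ?_, fun s t hs hst htT => ?_⟩
  · rw [(hZ t (hIoo t ht)).1]
    exact ⟨ENNReal.ofReal_pos.2 (hpos t ht), ENNReal.ofReal_lt_top⟩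
  · have hsI : s ∈ Ico t₁ T := ⟨hs, hst.trans_lt htT⟩
    have htI : t ∈ Ico t₁ T := ⟨hs.trans hst, htT⟩
    rw [(hZ s (hIoo s hsI)).1, (hZ t (hIoo t htI)).1, ENNReal.toReal_ofReal (hpos s hsI).le,
      ENNReal.toReal_ofReal (hpos t htI).le]
    have h := ProductionEfficiencyDecay.stub_integrateEfficiency Zr t₁ T (ε / 2) hpos hder s t hs hst htT
    linarith

/-- **On a velocity-Type-I blow-up the POINTWISE ε-law and the super-Leray FLOOR are EQUIVALENT.** (`→`: the lead's
`ProductionEfficiencyDecayNegative.floor_eventually_of_window_law`, real analysis + stmt-22867; `←`: §3.) The oscillation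
gap between the filed crux and its mean form (`…MeanFormSeparation`) is therefore confined to the velocity-Type-II
stratum. [folklore] -/
theorem efficiencyDecayLaw_iff_floor_of_isTypeIBlowup {ν T : ℝ} (hν : 0 < ν) (hT : 0 < T)
    {u : ℝ → EuclideanSpace ℝ (Fin 3) → EuclideanSpace ℝ (Fin 3)} {p : ℝ → EuclideanSpace ℝ (Fin 3) → ℝ}
    (hmax : IsMaximalSmoothSolution ν 0 u p T) (hLH : IsLerayHopfOn T ν 0 (u 0) u)
    (hdec : HasRapidSpatialDecay (u 0)) (hI : IsTypeIBlowup u T) :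
    (∀ ε : ℝ, 0 < ε → ∃ t₁ ∈ Set.Ico 0 T, (∀ t ∈ Set.Ico t₁ T,
        0 < ∫⁻ x, ‖curl (u t) x‖ₑ ^ 2 ∧ ∫⁻ x, ‖curl (u t) x‖ₑ ^ 2 < ⊤) ∧
        ∀ s t : ℝ, t₁ ≤ s → s ≤ t → t < T →
          ((∫⁻ x, ‖curl (u s) x‖ₑ ^ 2).toReal)⁻¹ ^ 2 - ((∫⁻ x, ‖curl (u t) x‖ₑ ^ 2).toReal)⁻¹ ^ 2 ≤
            ε * (t - s)) ↔
    (∀ K : ℝ, ∀ᶠ t in 𝓝[<] T, ENNReal.ofReal (K / Real.sqrt (T - t)) < ∫⁻ x, ‖curl (u t) x‖ₑ ^ 2) :=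
  ⟨fun hlaw K => ProductionEfficiencyDecayNegative.floor_eventually_of_window_law hν hT hmax hLH hdec hlaw K,
    fun hfloor => efficiencyDecayLaw_of_isTypeIBlowup_of_floor hν hT hmax hLH hdec hI hfloor⟩

/-! ### §4 By name: modulo the sibling crux 0056 the pointwise crux, its mean form and the floor coincide -/

/-- **0056 ∧ floor ⟹ the registered crux-proper stub S2** (`stub_depletionGivenBudget` of
`Cruxes/ProductionEfficiencyDecay/Lines/efficiency_floor.lean`, signature VERBATIM as the conclusion). Implication
between OPEN statements; the stub is NOT closed. [folklore] -/
theorem stub_depletionGivenBudget_of_noTypeII_of_floor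
    (h56 : Summit.NavierStokesRegularity.NavierStokesRegularity.Theses.TypeILiouville.TypeIliouvilleNoTypeII)
    (hF : ∀ (ν T : ℝ), 0 < ν → 0 < T → ∀ (u : ℝ → EuclideanSpace ℝ (Fin 3) → EuclideanSpace ℝ (Fin 3)) (p : ℝ →
      EuclideanSpace ℝ (Fin 3) → ℝ), Literature.Analysis.FluidPDE.IsMaximalSmoothSolution ν 0 u p T →
      Literature.Analysis.FluidPDE.IsLerayHopfOn T ν 0 (u 0) u → Literature.Analysis.FluidPDE.HasRapidSpatialDecay
      (u 0) → ∀ K : ℝ, ∀ᶠ t in nhdsWithin T (Set.Iio T), ENNReal.ofReal (K / Real.sqrt (T - t)) < ∫⁻ x,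
      ‖Literature.Analysis.FluidPDE.curl (u t) x‖ₑ ^ 2) :
    ∀ (c ν T : ℝ), 0 < c → 0 < ν → 0 < T → ∀ (u : ℝ → EuclideanSpace ℝ (Fin 3) → EuclideanSpace ℝ (Fin 3)) (p : ℝ → EuclideanSpace ℝ (Fin 3) → ℝ), Literature.Analysis.FluidPDE.IsMaximalSmoothSolution ν 0 u p T → Literature.Analysis.FluidPDE.IsLerayHopfOn T ν 0 (u 0) u → Literature.Analysis.FluidPDE.HasRapidSpatialDecay (u 0) → ∀ (Zr Pr Sr : ℝ → ℝ), (∀ t ∈ Set.Ioo 0 T, ∫⁻ x, ‖Literature.Analysis.FluidPDE.curl (u t) x‖ₑ ^ 2 = ENNReal.ofReal (Zr t) ∧ 0 ≤ Zr t ∧ 0 ≤ Pr t ∧ Pr t = ∫ x, Literature.Analysis.FluidPDE.frobeniusNormSq (fderiv ℝ (Literature.Analysis.FluidPDE.curl (u t)) x) ∧ Sr t = ∫ x, ⟪Literature.Analysis.FluidPDE.curl (u t) x, fderiv ℝ (u t) x (Literature.Analysis.FluidPDE.curl (u t) x)⟫_ℝ ∧ HasDerivAt Zr (2 * Sr t -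 2 * ν * Pr t) t ∧ |Sr t| ≤ c * Zr t ^ (3/4 : ℝ) * Pr t ^ (3/4 : ℝ)) → ∀ ε : ℝ, 0 < ε → ∃ t₁ ∈ Set.Ioo 0 T, ∀ t ∈ Set.Ico t₁ T, 0 < Zr t ∧ 2 * Sr t - 2 * ν * Pr t ≤ ε * Zr t ^ 3 :=
  fun _c ν T _hc hν hT u p hmax hLH hdec _Zr _Pr _Sr hZ _ε hε =>
    depletion_of_isTypeIBlowup_of_floor hν hT hmax hLH hdec (h56 ν T hν hT u p hmax hLH hdec)
      (hF ν T hν hT u p hmax hLH hdec) hZ hε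

/-- **0056 ∧ floor ⟹ the crux `ProductionEfficiencyDecay`, BY NAME.** Implication between OPEN statements; the crux is
NOT proved. [folklore] -/
theorem productionEfficiencyDecay_of_noTypeII_of_floor
    (h56 : Summit.NavierStokesRegularity.NavierStokesRegularity.Theses.TypeILiouville.TypeIliouvilleNoTypeII)
    (hF : ∀ (ν T : ℝ), 0 < ν → 0 < T → ∀ (u : ℝ → EuclideanSpace ℝ (Fin 3) → EuclideanSpace ℝ (Fin 3)) (p : ℝ →
      EuclideanSpace ℝ (Fin 3) → ℝ), Literature.Analysis.FluidPDE.IsMaximalSmoothSolution ν 0 u p T →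
      Literature.Analysis.FluidPDE.IsLerayHopfOn T ν 0 (u 0) u → Literature.Analysis.FluidPDE.HasRapidSpatialDecay
      (u 0) → ∀ K : ℝ, ∀ᶠ t in nhdsWithin T (Set.Iio T), ENNReal.ofReal (K / Real.sqrt (T - t)) < ∫⁻ x,
      ‖Literature.Analysis.FluidPDE.curl (u t) x‖ₑ ^ 2) :
    Summit.NavierStokesRegularity.NavierStokesRegularity.Theses.EfficiencyFloor.ProductionEfficiencyDecay := by
  intro ν T hν hT u p hmax hLH hdec ε hε
  exact efficiencyDecayLaw_of_isTypeIBlowup_of_floor hν hT hmax hLH hdec (h56 ν T hν hT u p hmax hLH hdec)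
    (hF ν T hν hT u p hmax hLH hdec) ε hε

/-- **Modulo 0056, the filed pointwise crux IS the super-Leray floor** (conclusion of stmt-22868 for every solution):
`TypeIliouvilleNoTypeII → (ProductionEfficiencyDecay ↔ floor)`. (`→` is the landed `MeanForm.superLerayFloor_of_productionEfficiencyDecay`,
unconditionally.) Equivalence of OPEN statements under an OPEN hypothesis; nothing is proved about any of them. [folklore] -/
theorem productionEfficiencyDecay_iff_floor_of_noTypeII
    (h56 : Summit.NavierStokesRegularity.NavierStokesRegularity.Theses.TypeILiouville.TypeIliouvilleNoTypeII) :
    Summit.NavierStokesRegularity.NavierStokesRegularity.Theses.EfficiencyFloor.ProductionEfficiencyDecay ↔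
    (∀ (ν T : ℝ), 0 < ν → 0 < T → ∀ (u : ℝ → EuclideanSpace ℝ (Fin 3) → EuclideanSpace ℝ (Fin 3)) (p : ℝ →
      EuclideanSpace ℝ (Fin 3) → ℝ), Literature.Analysis.FluidPDE.IsMaximalSmoothSolution ν 0 u p T →
      Literature.Analysis.FluidPDE.IsLerayHopfOn T ν 0 (u 0) u → Literature.Analysis.FluidPDE.HasRapidSpatialDecay
      (u 0) → ∀ K : ℝ, ∀ᶠ t in nhdsWithin T (Set.Iio T), ENNReal.ofReal (K / Real.sqrt (T - t)) < ∫⁻ x,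
      ‖Literature.Analysis.FluidPDE.curl (u t) x‖ₑ ^ 2) :=
  ⟨MeanForm.superLerayFloor_of_productionEfficiencyDecay, productionEfficiencyDecay_of_noTypeII_of_floor h56⟩

/-- **Modulo 0056, the filed pointwise crux IS its mean form** (`Z(s)⁻² ≤ ε(T−s)` late, with `0 < Z < ⊤`; the form the
route's deciding theorem consumes, p825059): `TypeIliouvilleNoTypeII → (ProductionEfficiencyDecay ↔ mean form)` — the
oscillation obstruction of `…MeanFormSeparation` does not occur on the velocity-Type-I stratum. Equivalence of OPEN
statements under an OPEN hypothesis. [folklore] -/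
theorem productionEfficiencyDecay_iff_meanForm_of_noTypeII
    (h56 : Summit.NavierStokesRegularity.NavierStokesRegularity.Theses.TypeILiouville.TypeIliouvilleNoTypeII) :
    Summit.NavierStokesRegularity.NavierStokesRegularity.Theses.EfficiencyFloor.ProductionEfficiencyDecay ↔
    (∀ (ν T : ℝ), 0 < ν → 0 < T → ∀ (u : ℝ → EuclideanSpace ℝ (Fin 3) → EuclideanSpace ℝ (Fin 3)) (p : ℝ →
      EuclideanSpace ℝ (Fin 3) → ℝ), Literature.Analysis.FluidPDE.IsMaximalSmoothSolution ν 0 u p T →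
      Literature.Analysis.FluidPDE.IsLerayHopfOn T ν 0 (u 0) u → Literature.Analysis.FluidPDE.HasRapidSpatialDecay
      (u 0) → ∀ ε : ℝ, 0 < ε → ∃ t₁ ∈ Set.Ico 0 T, ∀ s ∈ Set.Ico t₁ T, (0 < ∫⁻ x,
      ‖Literature.Analysis.FluidPDE.curl (u s) x‖ₑ ^ 2 ∧ ∫⁻ x, ‖Literature.Analysis.FluidPDE.curl (u s) x‖ₑ ^ 2 <
      ⊤) ∧ ((∫⁻ x, ‖Literature.Analysis.FluidPDE.curl (u s) x‖ₑ ^ 2).toReal)⁻¹ ^ 2 ≤ ε * (T - s)) :=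
  ⟨MeanForm.meanEfficiencyDecay_of_productionEfficiencyDecay, fun hM =>
    productionEfficiencyDecay_of_noTypeII_of_floor h56 (MeanForm.superLerayFloor_of_meanEfficiencyDecay hM)⟩

/-! ### §5 Instant-wise form: on the Type-I stratum every late violation instant is a Leray-rate instant

(Appended.) The contrapositive of §2 at ONE instant, with no floor hypothesis: where the efficiency law fails at level
`ε` (`ε Z³ < 2S − 2ν·Pal`, an `ε`-VIOLATION TIME in the sense of `…ViolationStructure`) and the velocity gradient is
bounded by `C/(T−t)`, the enstrophy is AT MOST at Leray's rate, `ε Z(t)² (T−t) ≤ 2C`. Combined with Leray's floor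
`Z(t)√(T−t) ≥ c_L ν^{3/2}` (`Violation.leray_floor_real`), the violation instants of a velocity-Type-I blow-up carry a
scale-invariant enstrophy `Z√(T−t)` pinned in the compact window `[c_L ν^{3/2}, √(2C/ε)]`; with `…TypeIRecurrence`
(Leray-rate instants force cubic-growth instants to recur) this is the instant-wise reading of §3: on the Type-I
stratum «the efficiency law fails arbitrarily late» and «Leray's rate recurs» are the same event. -/

/-- **At an `ε`-violation instant under a gradient bound, the enstrophy is at Leray's rate.** Along a maximal smooth
Leray–Hopf rapidly-decaying-datum solution with budget triple `(Z, Pal, S)` (clauses of stmt-22995 verbatim), at a time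
`t ∈ (0,T)` where `‖∇u(t,x)‖ ≤ C/(T−t)` for all `x` and `ε Z³ < 2S − 2ν·Pal` (any real `ε`): `ε · Z(t)² · (T − t) ≤ 2C`
(`2S ≤ 2C Z/(T−t)` by `stretching_le_of_norm_fderiv_le`, then divide by `Z > 0`; `Z = 0` is trivial since `C ≥ 0`).
[folklore] -/
theorem violation_lerayRate_of_norm_fderiv_le {c ν T : ℝ} (hν : 0 < ν) (hT : 0 < T)
    {u : ℝ → EuclideanSpace ℝ (Fin 3) → EuclideanSpace ℝ (Fin 3)} {p : ℝ → EuclideanSpace ℝ (Fin 3) → ℝ}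
    (hmax : IsMaximalSmoothSolution ν 0 u p T) (hLH : IsLerayHopfOn T ν 0 (u 0) u)
    (hdec : HasRapidSpatialDecay (u 0)) {Zr Pr Sr : ℝ → ℝ}
    (hZ : ∀ t ∈ Set.Ioo 0 T, ∫⁻ x, ‖curl (u t) x‖ₑ ^ 2 = ENNReal.ofReal (Zr t) ∧ 0 ≤ Zr t ∧ 0 ≤ Pr t ∧
      Pr t = ∫ x, frobeniusNormSq (fderiv ℝ (curl (u t)) x) ∧
      Sr t = ∫ x, ⟪curl (u t) x, fderiv ℝ (u t) x (curl (u t) x)⟫_ℝ ∧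
      HasDerivAt Zr (2 * Sr t - 2 * ν * Pr t) t ∧ |Sr t| ≤ c * Zr t ^ (3/4 : ℝ) * Pr t ^ (3/4 : ℝ))
    {t : ℝ} (ht : t ∈ Set.Ioo 0 T) {C : ℝ} (hgrad : ∀ x, ‖fderiv ℝ (u t) x‖ ≤ C / (T - t))
    {ε : ℝ} (hviol : ε * Zr t ^ 3 < 2 * Sr t - 2 * ν * Pr t) :
    ε * (Zr t ^ 2 * (T - t)) ≤ 2 * C := by
  obtain ⟨hZeq, hZ0, hP0, -, hSeq, -, -⟩ := hZ t ht
  have hTt : 0 < T - t := sub_pos.2 ht.2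
  obtain ⟨hsm, -, hsob, hZint⟩ := Violation.slice_data hν hT hmax hLH hdec ht hZeq hZ0
  have hS : Sr t ≤ C / (T - t) * Zr t := by
    rw [hSeq, hZint]
    exact stretching_le_of_norm_fderiv_le (hsm.of_le (by norm_cast)) (hsob 1) hgrad
  -- `C ≥ 0`: the gradient bound at one point
  have hC0 : 0 ≤ C := by
    have h : 0 ≤ C / (T - t) := (norm_nonneg _).trans (hgrad 0)
    by_contra hC
    exact absurd h (not_le.2 (div_neg_of_neg_of_pos (not_le.1 hC) hTt))
  have hνP : 0 ≤ 2 * ν * Pr t := by positivity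
  have hmain : ε * Zr t ^ 2 * Zr t < 2 * C / (T - t) * Zr t := by
    calc ε * Zr t ^ 2 * Zr t = ε * Zr t ^ 3 := by ring
      _ < 2 * Sr t - 2 * ν * Pr t := hviol
      _ ≤ 2 * (C / (T - t) * Zr t) := by linarith
      _ = 2 * C / (T - t) * Zr t := by ring
  rcases hZ0.eq_or_lt with hz | hz
  · -- `Zr t = 0`: the left side vanishes
    rw [← hz]
    have : (0 : ℝ) ≤ 2 * C := by positivity
    simpa using this
  · have h1 : ε * Zr t ^ 2 < 2 * C / (T - t) := lt_of_mul_lt_mul_right hmain hz.le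
    have h2 : ε * Zr t ^ 2 * (T - t) < 2 * C := (lt_div_iff₀ hTt).1 h1
    rw [← mul_assoc]
    exact h2.le

/-- **On a velocity-Type-I blow-up, late violation instants are Leray-rate instants.** Along a maximal smooth
Leray–Hopf rapidly-decaying-datum solution with a velocity-Type-I blow-up at `T` there are `C ≥ 0` and `t₁ ∈ (0,T)`
such that for every budget triple, at every `t ∈ [t₁,T)` and every level `ε > 0`, failure of the efficiency law
(`ε Z³ < 2S − 2ν·Pal`) forces `ε Z(t)² (T−t) ≤ 2C`, i.e. `Z(t) √(T−t) ≤ √(2C/ε)` (KNSS gradient rate + the previous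
theorem). Nothing is asserted about whether violation instants occur. [cite: KochNadirashviliSereginSverak2009, §4 (4.10)] -/
theorem violation_lerayRate_of_isTypeIBlowup {c ν T : ℝ} (hν : 0 < ν) (hT : 0 < T)
    {u : ℝ → EuclideanSpace ℝ (Fin 3) → EuclideanSpace ℝ (Fin 3)} {p : ℝ → EuclideanSpace ℝ (Fin 3) → ℝ}
    (hmax : IsMaximalSmoothSolution ν 0 u p T) (hLH : IsLerayHopfOn T ν 0 (u 0) u)
    (hdec : HasRapidSpatialDecay (u 0)) (hI : IsTypeIBlowup u T) :
    ∃ C : ℝ, 0 ≤ C ∧ ∃ t₁ ∈ Set.Ioo 0 T, ∀ (Zr Pr Sr : ℝ → ℝ),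
      (∀ t ∈ Set.Ioo 0 T, ∫⁻ x, ‖curl (u t) x‖ₑ ^ 2 = ENNReal.ofReal (Zr t) ∧ 0 ≤ Zr t ∧ 0 ≤ Pr t ∧
        Pr t = ∫ x, frobeniusNormSq (fderiv ℝ (curl (u t)) x) ∧
        Sr t = ∫ x, ⟪curl (u t) x, fderiv ℝ (u t) x (curl (u t) x)⟫_ℝ ∧
        HasDerivAt Zr (2 * Sr t - 2 * ν * Pr t) t ∧ |Sr t| ≤ c * Zr t ^ (3/4 : ℝ) * Pr t ^ (3/4 : ℝ)) →
      ∀ t ∈ Set.Ico t₁ T, ∀ ε : ℝ, 0 < ε →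
        ε * Zr t ^ 3 < 2 * Sr t - 2 * ν * Pr t → ε * (Zr t ^ 2 * (T - t)) ≤ 2 * C := by
  obtain ⟨C, hC⟩ :=
    EnstrophyQuarterLaw.LambBudget.gradientTypeIOfTypeI ν T hν hT u p hmax hLH hdec hI
  have hIoo : ∀ᶠ t in 𝓝[<] T, t ∈ Ioo 0 T := Ioo_mem_nhdsLT hT
  obtain ⟨T₁, hT₁T, hsub⟩ := mem_nhdsLT_iff_exists_Ioo_subset.1 (hIoo.and hC)
  set t₁ : ℝ := (max T₁ 0 + T) / 2 with ht₁
  have hm : max T₁ 0 < T := max_lt hT₁T hT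
  have ht₁I : t₁ ∈ Ioo 0 T := ⟨by rw [ht₁]; linarith [le_max_right T₁ 0], by rw [ht₁]; linarith⟩
  refine ⟨max C 0, le_max_right _ _, t₁, ht₁I, fun Zr Pr Sr hZ t ht ε _ hviol => ?_⟩
  have hT₁t : T₁ < t := by
    have : max T₁ 0 < t₁ := by rw [ht₁]; linarith
    exact (le_max_left T₁ 0).trans_lt (this.trans_le ht.1)
  obtain ⟨htI, hgrad⟩ := hsub ⟨hT₁t, ht.2⟩
  have hTt : 0 < T - t := sub_pos.2 ht.2
  have hgrad' : ∀ x, ‖fderiv ℝ (u t) x‖ ≤ max C 0 / (T - t) := fun x =>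
    (hgrad x).trans (div_le_div_of_nonneg_right (le_max_left C 0) hTt.le)
  exact violation_lerayRate_of_norm_fderiv_le hν hT hmax hLH hdec hZ htI hgrad' hviol

end TypeIStratum

end ProductionEfficiencyDecay

end Summit.NavierStokesRegularity.NavierStokesRegularity.Theorems

end
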